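import Mathlib
import Summits.KontsevichZagierPeriods.KontsevichZagierPeriods.Theses.InverseLandau
import Literature.NumberTheory.Transcendental.KZCalculus
import Literature.NumberTheory.Transcendental.KZLogCalculusProofs
import Summits.KontsevichZagierPeriods.KontsevichZagierPeriods.Theorems.InverseLandauTateLiftingLowDimAlgSector
import Summits.KontsevichZagierPeriods.KontsevichZagierPeriods.Theorems.InverseLandauTateLiftingPullback
import Summits.KontsevichZagierPeriods.KontsevichZagierPeriods.Theorems.CompiledSubstitutionsPiNormalisation
import Summits.KontsevichZagierPeriods.KontsevichZagierPeriods.Theorems.CobordismMoveCP2VolumeCharts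
import Summits.KontsevichZagierPeriods.KontsevichZagierPeriods.Theorems.BetaCancellation.Negative.EulerReflectionStub
import Summits.KontsevichZagierPeriods.KontsevichZagierPeriods.Theorems.TerasomaMultiplicationBetaCancellationStubEulerRationalise

/-!
# `TateLifting` (stmt-KontsevichZagierPeriods-9129), line `Sketch` — Euler reflection at rational
# arguments, inside the rules

Stub `stub_eulerReflectionRational` of the crux `TateLifting` (kernel form of the Kontsevich–Zagier
period conjecture), verbatim the item `EulerReflectionRational` (stmt-KontsevichZagierPeriods-3383) of
route CompiledSubstitutions: for every rational `0 < a < 1`, every representation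
`r = [(0,1), sin(πa)·x^{a−1}(1−x)^{−a}]` (value `sin(πa)·B(a,1−a) = π`, Euler's reflection formula) is
KZ-equivalent to every integrand-`1` representation `p` of the closed unit disc (value `π`).

## Proof (`tateLifting_eulerReflectionRational`)

Write `a = m/q` with naturals `0 < m < q` (`exists_nat_div`).

* ONE change of variables (rule (2), the honest pull-back `tateLifting_pullback_dimOne` of
  Theorems/InverseLandauTateLiftingPullback.lean): the `ℚ`-rational chart `x = φ(t) = t^q/(1+t^q)`
  maps `(0,∞)` bijectively onto `(0,1)` (`injOn_chart`, `image_chart`) with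
  `φ'(t) = q t^{q−1}/(1+t^q)²` (`ratz_hasDerivAt_chart`), and the Jacobian identity
  `φ'(t) · φ(t)^{a−1} (1−φ(t))^{−a} = q·t^{m−1}/(1+t^q)` (`ratz_kernel_identity`, both from the
  tree's Theorems/TerasomaMultiplicationBetaCancellationStubEulerRationalise.lean) shows that the
  pulled-back representation `R = [(0,∞), sin(πa)·q·t^{m−1}/(1+t^q)]` has a RATIONAL integrand with
  the algebraic coefficient `sin(πa)` (`isAlgebraic_sin_pi_mul_rat`); `r ∼ R`.
* `value R = value r = π` (soundness of the moves and `value_eulerRep`, i.e. Mathlib's reflection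
  formula `Γ(a)Γ(1−a) = π/sin(πa)`), and the Cauchy representation `L = [ℝ, 1/(1+t²)]`
  (`exists_cauchyRep₁`) has value `π` (`L ∼ p`, `value_discPinned`); both are dimension-one
  representations with algebraic-coefficient rational integrands, so `R ∼ L` by THE DIMENSION-ONE
  KERNEL THEOREM with algebraic coefficients `kzPeriodConjecture_dim_one_algCoeff`
  (Theorems/InverseLandauTateLiftingLowDimAlgSector.lean, resting on Baker's theorem).
* `L ∼ p` is the tree's `PiNormalisation` (route CompiledSubstitutions, `piNormalisation_proof`).

References: M. Kontsevich, D. Zagier, *Periods* (2001), §1.1 eq. (1), §1.2; G. Andrews, R. Askey,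
R. Roy, *Special Functions* (1999), Thm. 1.2.1; A. Baker, *Transcendental Number Theory* (1975),
Thm 2.1.
-/

noncomputable section

namespace Summit.KontsevichZagierPeriods.InverseLandau

open MeasureTheory Set
open Literature.NumberTheory.Transcendental
open Literature.ModelTheory.ExponentialFields (IsSemialgebraic isSemialgebraic_setOf_eval_pos)

namespace EulerReflectionRational

/-! ## Arithmetic of the exponent -/

/-- A rational `0 < a < 1` is `m/q` with naturals `0 < m < q` (numerator and denominator).
[folklore] -/
theorem exists_nat_div {a : ℚ} (ha : 0 < a) (ha1 : a < 1) :
    ∃ m q : ℕ, 0 < m ∧ m < q ∧ (a : ℝ) = m / q := by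
  have hq : 0 < a.den := a.den_pos
  have hn : ((a.num.toNat : ℕ) : ℤ) = a.num := Int.toNat_of_nonneg (Rat.num_nonneg.2 ha.le)
  have hcast : (a : ℝ) = (a.num.toNat : ℕ) / (a.den : ℕ) := by
    rw [Rat.cast_def]
    congr 1
    exact_mod_cast hn.symm
  refine ⟨a.num.toNat, a.den, ?_, ?_, hcast⟩
  · have h := Rat.num_pos.2 ha
    omega
  · have h1 : ((a.num.toNat : ℕ) : ℝ) / (a.den : ℕ) < 1 := by
      rw [← hcast]
      exact_mod_cast ha1
    have h2 : ((a.num.toNat : ℕ) : ℝ) < (a.den : ℕ) := by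
      rwa [div_lt_one (by exact_mod_cast hq)] at h1
    exact_mod_cast h2

/-! ## The chart `φ(t) = t^q/(1+t^q)` on `(0,∞)` -/

/-- The chart `φ(t) = t^q/(1+t^q)`, read on the coordinate, is a `ℚ`-semialgebraic FUNCTION on any
`ℚ`-semialgebraic set where `t ≥ 0` (a quotient of `ℚ`-polynomials with non-vanishing denominator).
[cite: BCR1998, §2.2] -/
theorem isSemialgebraicFunOn_chart (q : ℕ) {s : Set (Fin 1 → ℝ)} (hs : IsSemialgebraic ℚ s)
    (hpos : ∀ y ∈ s, 0 ≤ y 0) :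
    IsSemialgebraicFunOn ℚ s (fun y => (y 0) ^ q / (1 + (y 0) ^ q)) := by
  refine (isSemialgebraicFunOn_aeval_div_aeval hs
    (MvPolynomial.X 0 ^ q : MvPolynomial (Fin 1) ℚ) (1 + MvPolynomial.X 0 ^ q)
    fun y hy => ?_).congr fun y _ => ?_
  · have hy' : (0:ℝ) ≤ y 0 := hpos y hy
    have h : (0:ℝ) < 1 + (y 0) ^ q := by positivity
    simpa using h.ne'
  · simp

/-- The Jacobian `φ'(t) = q t^{q−1}/(1+t^q)²`, read on the coordinate, is a `ℚ`-semialgebraic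
function on any `ℚ`-semialgebraic set where `t ≥ 0`. [cite: BCR1998, §2.2] -/
theorem isSemialgebraicFunOn_jac (q : ℕ) {s : Set (Fin 1 → ℝ)} (hs : IsSemialgebraic ℚ s)
    (hpos : ∀ y ∈ s, 0 ≤ y 0) :
    IsSemialgebraicFunOn ℚ s (fun y => (q:ℝ) * (y 0) ^ (q - 1) / (1 + (y 0) ^ q) ^ 2) := by
  refine (isSemialgebraicFunOn_aeval_div_aeval hs
    (MvPolynomial.C (q:ℚ) * MvPolynomial.X 0 ^ (q - 1) : MvPolynomial (Fin 1) ℚ)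
    ((1 + MvPolynomial.X 0 ^ q) ^ 2) fun y hy => ?_).congr fun y _ => ?_
  · have hy' : (0:ℝ) ≤ y 0 := hpos y hy
    have h : (0:ℝ) < (1 + (y 0) ^ q) ^ 2 := by positivity
    simpa using h.ne'
  · simp

/-- The chart is injective on the ray `(0,∞)` (`t ↦ t^q` is injective on positive reals, `q ≠ 0`),
read on `ℝ¹`. [folklore] -/
theorem injOn_chart (q : ℕ) (hq : q ≠ 0) :
    Set.InjOn (fun y : Fin 1 → ℝ => fun _ : Fin 1 => (y 0) ^ q / (1 + (y 0) ^ q))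
      {y : Fin 1 → ℝ | 0 < y 0} := by
  intro y hy z hz hyz
  have hy' : (0:ℝ) < y 0 := hy
  have hz' : (0:ℝ) < z 0 := hz
  have h0 : (y 0) ^ q / (1 + (y 0) ^ q) = (z 0) ^ q / (1 + (z 0) ^ q) := congrFun hyz 0
  have hvy : (0:ℝ) < 1 + (y 0) ^ q := by positivity
  have hvz : (0:ℝ) < 1 + (z 0) ^ q := by positivity
  rw [div_eq_div_iff hvy.ne' hvz.ne'] at h0
  have h1 : (y 0) ^ q = (z 0) ^ q := by linear_combination h0
  have h2 : y 0 = z 0 := (pow_left_inj₀ hy'.le hz'.le hq).1 h1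
  funext i
  rw [Fin.fin_one_eq_zero i]
  exact h2

/-- The chart maps the ray `(0,∞)` onto `(0,1)` (inverse `t = (x/(1−x))^{1/q}`), read on `ℝ¹`.
[folklore] -/
theorem image_chart (q : ℕ) (hq : q ≠ 0) :
    (fun y : Fin 1 → ℝ => fun _ : Fin 1 => (y 0) ^ q / (1 + (y 0) ^ q)) ''
        {y : Fin 1 → ℝ | 0 < y 0} = {x | x 0 ∈ Set.Ioo (0:ℝ) 1} := by
  ext x
  constructor
  · rintro ⟨y, hy, rfl⟩
    have hy' : (0:ℝ) < y 0 := hy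
    have hv : (0:ℝ) < 1 + (y 0) ^ q := by positivity
    show (y 0) ^ q / (1 + (y 0) ^ q) ∈ Set.Ioo (0:ℝ) 1
    exact ⟨div_pos (pow_pos hy' q) hv, (div_lt_one hv).2 (lt_one_add _)⟩
  · intro hx
    have hx' : x 0 ∈ Set.Ioo (0:ℝ) 1 := hx
    have h1 : (0:ℝ) < 1 - x 0 := by linarith [hx'.2]
    have hw : 0 < x 0 / (1 - x 0) := div_pos hx'.1 h1
    have ht : 0 < (x 0 / (1 - x 0)) ^ ((q:ℝ)⁻¹) := Real.rpow_pos_of_pos hw _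
    have htq : ((x 0 / (1 - x 0)) ^ ((q:ℝ)⁻¹)) ^ q = x 0 / (1 - x 0) :=
      Real.rpow_inv_natCast_pow hw.le hq
    refine ⟨fun _ => (x 0 / (1 - x 0)) ^ ((q:ℝ)⁻¹), ?_, ?_⟩
    · show (0:ℝ) < (x 0 / (1 - x 0)) ^ ((q:ℝ)⁻¹)
      exact ht
    · funext i
      rw [Fin.fin_one_eq_zero i]
      show ((x 0 / (1 - x 0)) ^ ((q:ℝ)⁻¹)) ^ q / (1 + ((x 0 / (1 - x 0)) ^ ((q:ℝ)⁻¹)) ^ q) = x 0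
      rw [htq]
      field_simp
      ring

/-! ## Algebraic coefficients of the two rational integrands -/

/-- The coefficients of `C c · X^n` (`c` algebraic) and of `1 + X^k` in `ℝ[x]` are `ℚ`-algebraic.
[folklore] -/
theorem isAlgebraic_coeffs {c : ℝ} (hc : IsAlgebraic ℚ c) (n k : ℕ) :
    (∀ i, IsAlgebraic ℚ ((Polynomial.C c * Polynomial.X ^ n : Polynomial ℝ).coeff i)) ∧
      ∀ i, IsAlgebraic ℚ ((1 + Polynomial.X ^ k : Polynomial ℝ).coeff i) := by
  refine ⟨fun i => ?_, fun i => ?_⟩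
  · rw [Polynomial.coeff_C_mul_X_pow]
    split_ifs
    · exact hc
    · exact isAlgebraic_zero
  · have h : (1 + Polynomial.X ^ k : Polynomial ℝ) =
        (1 + Polynomial.X ^ k : Polynomial ℚ).map (algebraMap ℚ ℝ) := by
      simp
    rw [h, Polynomial.coeff_map]
    exact isAlgebraic_algebraMap _

end EulerReflectionRational

open EulerReflectionRational
open Summit.KontsevichZagierPeriods.KontsevichZagierPeriods.BetaCancellationNegative
  (value_eulerRep value_discPinned isAlgebraic_sin_pi_mul_rat)
open Summit.KontsevichZagierPeriods.KontsevichZagierPeriods.BetaCancellationLine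
  (ratz_kernel_identity ratz_hasDerivAt_chart)

/-- **Euler reflection at rational arguments, inside the rules** (item `EulerReflectionRational`,
stmt-KontsevichZagierPeriods-3383, route CompiledSubstitutions; stub `stub_eulerReflectionRational` of
line `Sketch` of crux `TateLifting`): for rational `0 < a < 1`, every
`r = [(0,1), sin(πa)·x^{a−1}(1−x)^{−a}]` is KZ-equivalent to every integrand-`1` representation `p`
of the closed unit disc. Chain (`a = m/q`): `r ∼ R = [(0,∞), sin(πa)·q·t^{m−1}/(1+t^q)]` by ONE change
of variables `x = t^q/(1+t^q)` (rule (2), `tateLifting_pullback_dimOne` + `ratz_kernel_identity`);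
`R ∼ L = [ℝ, 1/(1+t²)]` by the dimension-one kernel theorem with algebraic coefficients
`kzPeriodConjecture_dim_one_algCoeff` (both values are `π`: `sin(πa)·B(a,1−a) = π` and
`∫ dt/(1+t²) = π`); `L ∼ p` is `PiNormalisation`. [cite: KontsevichZagier2001, §1.2] -/
theorem tateLifting_eulerReflectionRational :
    ∀ a : ℚ, 0 < a → a < 1 → ∀ (r : KZ.IntegralRep 1) (p : KZ.IntegralRep 2), r.domain = {x | x 0 ∈ Set.Ioo (0:ℝ) 1} → Set.EqOn r.integrand (fun x => Real.sin (Real.pi * a) * (x 0) ^ ((a : ℝ) - 1) * (1 - x 0) ^ (-(a : ℝ))) r.domain → p.domain = {z | z 0 ^ 2 + z 1 ^ 2 ≤ 1} → Set.EqOn p.integrand (fun _ => 1) p.domain → KZ.Equivalent r p := by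
  intro a ha ha1 r p hrd hri hpd hpi
  -- `a = m/q`
  obtain ⟨m, q, hm, hmq, ha'⟩ := exists_nat_div ha ha1
  have hq0 : q ≠ 0 := (hm.trans hmq).ne'
  -- (1) pull `r` back along the chart `x = t^q/(1+t^q)` on `D = (0,∞)`
  have hD : IsSemialgebraic ℚ {y : Fin 1 → ℝ | 0 < y 0} := by
    simpa using isSemialgebraic_setOf_eval_pos (k := ℚ) (R := ℝ)
      (MvPolynomial.X 0 : MvPolynomial (Fin 1) ℚ)
  have hDpos : ∀ y ∈ {y : Fin 1 → ℝ | 0 < y 0}, 0 ≤ y 0 := fun y hy => le_of_lt hy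
  have hder : ∀ y ∈ {y : Fin 1 → ℝ | 0 < y 0}, HasDerivAt (fun t : ℝ => t ^ q / (1 + t ^ q))
      ((fun t : ℝ => (q:ℝ) * t ^ (q - 1) / (1 + t ^ q) ^ 2) (y 0)) (y 0) :=
    fun y hy => ratz_hasDerivAt_chart q (hDpos y hy)
  have himg : (fun y : Fin 1 → ℝ => fun _ : Fin 1 => (fun t : ℝ => t ^ q / (1 + t ^ q)) (y 0)) ''
      {y : Fin 1 → ℝ | 0 < y 0} = r.domain := by
    rw [hrd]
    exact image_chart q hq0
  have hJdet : ∀ y ∈ {y : Fin 1 → ℝ | 0 < y 0}, (fun y : Fin 1 → ℝ =>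
      (q:ℝ) * (y 0) ^ (q - 1) / (1 + (y 0) ^ q) ^ 2) y =
        |(fun t : ℝ => (q:ℝ) * t ^ (q - 1) / (1 + t ^ q) ^ 2) (y 0)| := by
    intro y hy
    have hy' : (0:ℝ) < y 0 := hy
    exact (abs_of_nonneg (by positivity)).symm
  obtain ⟨R, hRd, hRi, hrel⟩ := tateLifting_pullback_dimOne r {y : Fin 1 → ℝ | 0 < y 0}
    (fun t : ℝ => t ^ q / (1 + t ^ q)) (fun t : ℝ => (q:ℝ) * t ^ (q - 1) / (1 + t ^ q) ^ 2)
    (fun y : Fin 1 → ℝ => (q:ℝ) * (y 0) ^ (q - 1) / (1 + (y 0) ^ q) ^ 2) hD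
    (isSemialgebraicFunOn_chart q hD hDpos) hder (injOn_chart q hq0) himg
    (isSemialgebraicFunOn_jac q hD hDpos) hJdet
  have hrR : KZ.Equivalent r R := hrel
  -- (2) `R` has the algebraic-coefficient rational integrand `sin(πa)·q·t^{m−1}/(1+t^q)` on `(0,∞)`
  set P : Polynomial ℝ := Polynomial.C (Real.sin (Real.pi * a) * q) * Polynomial.X ^ (m - 1)
    with hP_def
  set Q : Polynomial ℝ := 1 + Polynomial.X ^ q with hQ_def
  obtain ⟨hPa, hQa⟩ :=
    isAlgebraic_coeffs ((isAlgebraic_sin_pi_mul_rat ha).mul (isAlgebraic_nat q)) (m - 1) q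
  have hQ0 : ∀ x ∈ R.domain, Q.eval (x 0) ≠ 0 := by
    intro x hx
    rw [hRd] at hx
    have hx' : (0:ℝ) < x 0 := hx
    have h : (0:ℝ) < 1 + (x 0) ^ q := by positivity
    simpa [hQ_def] using h.ne'
  have hRread : Set.EqOn R.integrand (fun x => P.eval (x 0) / Q.eval (x 0)) R.domain := by
    intro y hy
    rw [hRd] at hy
    have hy' : (0:ℝ) < y 0 := hy
    have huS : (fun _ : Fin 1 => (fun t : ℝ => t ^ q / (1 + t ^ q)) (y 0)) ∈ r.domain := by
      rw [← himg]
      exact mem_image_of_mem _ hy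
    rw [hRi]
    show (q:ℝ) * (y 0) ^ (q - 1) / (1 + (y 0) ^ q) ^ 2 *
        r.integrand (fun _ : Fin 1 => (fun t : ℝ => t ^ q / (1 + t ^ q)) (y 0)) =
      P.eval (y 0) / Q.eval (y 0)
    rw [hri huS]
    simp only [hP_def, hQ_def, Polynomial.eval_mul, Polynomial.eval_C, Polynomial.eval_pow,
      Polynomial.eval_X, Polynomial.eval_add, Polynomial.eval_one]
    rw [ha']
    linear_combination Real.sin (Real.pi * ((m:ℝ) / q)) * ratz_kernel_identity hm hmq hy'
  -- (3) the Cauchy representation `L = [ℝ, 1/(1+t²)]`, `L ∼ p` (`PiNormalisation`)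
  obtain ⟨L, hLd, hLi⟩ := Summit.KontsevichZagierPeriods.CobordismMove.CP2Volume.exists_cauchyRep₁
  have hLp : KZ.Equivalent L p :=
    (Summit.KontsevichZagierPeriods.CompiledSubstitutions.PiNormalisation.piNormalisation_proof p
      hpd hpi).1 L hLd (fun x _ => by rw [hLi])
  obtain ⟨hPa', hQa'⟩ := isAlgebraic_coeffs (isAlgebraic_one (R := ℚ) (A := ℝ)) 0 2
  have hL0 : ∀ x ∈ L.domain, (1 + Polynomial.X ^ 2 : Polynomial ℝ).eval (x 0) ≠ 0 := by
    intro x _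
    have h : (0:ℝ) < 1 + (x 0) ^ 2 := by positivity
    simpa using h.ne'
  have hLread : Set.EqOn L.integrand
      (fun x => (Polynomial.C 1 * Polynomial.X ^ 0 : Polynomial ℝ).eval (x 0) /
        (1 + Polynomial.X ^ 2 : Polynomial ℝ).eval (x 0)) L.domain := by
    intro x _
    rw [hLi]
    simp
  -- (4) values: `value R = value r = π = value p = value L`
  have hv : R.value = L.value := by
    rw [← KZ.Equivalent.value_eq_holds hrR, value_eulerRep ha ha1 r hrd hri,
      KZ.Equivalent.value_eq_holds hLp, value_discPinned p hpd hpi]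
  -- (5) the dimension-one kernel theorem with algebraic coefficients: `R ∼ L`
  have hRL : KZ.Equivalent R L :=
    kzPeriodConjecture_dim_one_algCoeff R L P Q _ _ hPa hQa hQ0 hRread hPa' hQa' hL0 hLread hv
  exact (hrR.trans hRL).trans hLp

end Summit.KontsevichZagierPeriods.InverseLandau

end
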